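import Literature.Topology.FourManifolds.ReducibleTrisectionSeparatingSides
import Mathlib.Analysis.Calculus.InverseFunctionTheorem.ContDiff
import HarnessLib

/-!
# Flat charts of a curve on the central surface of a trisection

Topic `Literature/Topology/FourManifolds`; the third proved step on the road to the named fact
`Literature.Topology.FourManifolds.Trisection.isConnectedSum_of_reducing_separating`
(`ReducibleTrisectionSplitting.lean`): the differential-topological input shared by
`ReducibleTrisectionSeparatingSides.lean` (separating case) and
`ReducibleTrisectionNonSeparatingPi1Charts.lean` (non-separating case) — **flat charts of the
pair `(F, δ)`** for a curve `δ` (`Trisection.IsCurve`: the image of a smooth embedding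
`γ : S¹ → X`) on the central surface `F = ⋂ l, S l` of a Gay–Kirby trisection.  **Everything here
is proved; no definitions, no named facts.**

* `IsGKTrisection.exists_planeChart` — the central surface is a topological surface with charts
  read in the linear charts of `IsGKTrisection.exists_linearChart`: at `p ∈ F` an open partial
  homeomorphism `e₀` of the subspace `F` to `ℝ × ℝ`, `e₀ y = ((A⁻¹ ψ y)₂, (A⁻¹ ψ y)₃)`;
  `continuous_planeEmbed` (elementary).
* `IsGKTrisection.exists_flatChart_of_isCurve` — at every point of a curve `δ` on `F` there is
  an open partial homeomorphism `e` of the subspace `F` to `ℝ × ℝ` with `e p = 0` and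
  `δ ∩ e.source = {e₂ = 0}`: in the plane chart `e₀` the curve is a smooth regular plane curve
  (its velocity is the image of a tangent vector of `S¹` under the injective differentials of
  `γ`, of a chart transition of `X` and of `A⁻¹`, and it is tangent to the plane of `F`), which
  is straightened by the inverse function theorem applied to `(s, r) ↦ c(s) + r • n`.
* `IsGKTrisection.exists_two_sides_of_not_isNonSeparating'` — corollary: the two sides of a
  SEPARATING curve on the central surface (`IsGKTrisection.exists_two_sides_of_not_isNonSeparating`
  made unconditional).

## References

* D. Gay, R. Kirby, *Trisecting 4-manifolds*, Geom. Topol. 20 (2016), Def. 1 and Fig. 1.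
  [GayKirby2016]
* R. Aranda, A. Zupan, *Manifolds with weakly reducible genus-three trisections are standard*,
  arXiv:2503.04607 (2025), §2 (curves on the central surface, p. 3; reducing curves, p. 6).
  [ArandaZupan2025]
* A. Kosinski, *Differential Manifolds*, Academic Press (1993), II.2 (slice charts).
-/

noncomputable section

open Set Function Filter Topology Metric
open scoped Manifold ContDiff

namespace Literature.Topology.FourManifolds

universe u

variable {X : Type u} [TopologicalSpace X] [T2Space X] [ChartedSpace (EuclideanSpace ℝ (Fin 4)) X]
  {g : ℕ} {k : Fin 3 → ℕ} {S : Fin 3 → Set X}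

/-! ### Plane charts of the central surface -/

/-- The embedding `(a, b) ↦ (0, 0, a, b) = a e₂ + b e₃` of `ℝ × ℝ` onto the plane `{q₀ = q₁ = 0}`
of `ℝ⁴` is continuous. [folklore] -/
theorem continuous_planeEmbed :
    Continuous fun v : ℝ × ℝ => (v.1 • EuclideanSpace.single (2 : Fin 4) (1 : ℝ) +
      v.2 • EuclideanSpace.single (3 : Fin 4) (1 : ℝ) : EuclideanSpace ℝ (Fin 4)) :=
  (continuous_fst.smul continuous_const).add (continuous_snd.smul continuous_const)

/-- **Plane charts of the central surface.**  At a point `p` of the central surface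
`F = ⋂ l, S l` of a Gay–Kirby trisection, with `(ψ, A, O)` a linear chart of
`IsGKTrisection.exists_linearChart` at `p` (`F ∩ O = {A⁻¹ψ ∈ Q, (A⁻¹ψ)₀ = (A⁻¹ψ)₁ = 0}`), the map
`y ↦ ((A⁻¹ ψ y)₂, (A⁻¹ ψ y)₃)` is an open partial homeomorphism of the subspace `F` to `ℝ × ℝ`
with source the trace of `O`. [cite: GayKirby2016, Def. 1 and Fig. 1] -/
theorem IsGKTrisection.exists_planeChart (h : IsGKTrisection X g k S) {p : X}
    (hp : p ∈ ⋂ l, S l) :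
    ∃ (ψ : OpenPartialHomeomorph X (EuclideanSpace ℝ (Fin 4)))
      (A : (EuclideanSpace ℝ (Fin 4)) ≃L[ℝ] (EuclideanSpace ℝ (Fin 4))) (O : Set X)
      (e₀ : OpenPartialHomeomorph ↥(⋂ l, S l) (ℝ × ℝ)),
      ψ ∈ IsManifold.maximalAtlas (𝓡 4) ∞ X ∧ IsOpen O ∧ p ∈ O ∧ O ⊆ ψ.source ∧ ψ p = 0 ∧
      (∀ y ∈ O, y ∈ (⋂ l, S l) → A.symm (ψ y) 0 = 0 ∧ A.symm (ψ y) 1 = 0) ∧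
      e₀.source = Subtype.val ⁻¹' O ∧
      (∀ y : ↥(⋂ l, S l), e₀ y = (A.symm (ψ y) 2, A.symm (ψ y) 3)) ∧
      (∀ y ∈ e₀.source, ψ y = A ((e₀ y).1 • EuclideanSpace.single (2 : Fin 4) (1 : ℝ) +
        (e₀ y).2 • EuclideanSpace.single (3 : Fin 4) (1 : ℝ))) := by
  classical
  obtain ⟨ψ, A, O, hψ, hOo, hpO, hOψ, hψ0, -, hF, -⟩ := h.exists_linearChart 0 hp
  -- the embedding of the plane and the projection
  set ι : ℝ × ℝ → EuclideanSpace ℝ (Fin 4) := fun v =>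
    v.1 • EuclideanSpace.single (2 : Fin 4) (1 : ℝ) + v.2 • EuclideanSpace.single (3 : Fin 4) (1 : ℝ)
    with hι
  set P : EuclideanSpace ℝ (Fin 4) → ℝ × ℝ := fun q => (q 2, q 3) with hP
  have hιc : Continuous ι := continuous_planeEmbed
  have hPc : Continuous P :=
    ((EuclideanSpace.proj (2 : Fin 4) (𝕜 := ℝ)).continuous).prodMk
      ((EuclideanSpace.proj (3 : Fin 4) (𝕜 := ℝ)).continuous)
  have hPι : ∀ v, P (ι v) = v := fun v => by
    simp only [hP, hι]
    ext <;> simp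
  have hιP : ∀ q : EuclideanSpace ℝ (Fin 4), q 0 = 0 → q 1 = 0 → ι (P q) = q := fun q h0 h1 => by
    ext i
    fin_cases i <;> simp [hι, hP, h0, h1]
  have hιQ : ∀ v, ι v ∈ cornerQuadrant ∧ ι v 0 = 0 ∧ ι v 1 = 0 := fun v => by
    refine ⟨⟨?_, ?_⟩, ?_, ?_⟩ <;> simp [hι]
  -- the target
  set T₀ : Set (ℝ × ℝ) := {v | A (ι v) ∈ ψ.target ∧ ψ.symm (A (ι v)) ∈ O} with hT₀
  have hT₀o : IsOpen T₀ := by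
    have h1 : IsOpen (ψ.target ∩ ψ.symm ⁻¹' O) :=
      ψ.continuousOn_symm.isOpen_inter_preimage ψ.open_target hOo
    exact h1.preimage (A.continuous.comp hιc)
  -- membership in `F` of the inverse images
  have hmemF : ∀ v ∈ T₀, ψ.symm (A (ι v)) ∈ ⋂ l, S l := fun v hv => by
    have hq : A.symm (ψ (ψ.symm (A (ι v)))) = ι v := by
      rw [ψ.right_inv hv.1]; simp
    refine (hF _ hv.2).2 ?_
    rw [hq]
    exact hιQ v
  set e₀ : OpenPartialHomeomorph ↥(⋂ l, S l) (ℝ × ℝ) :=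
    { toFun := fun y => P (A.symm (ψ y))
      invFun := fun v => if hv : v ∈ T₀ then ⟨ψ.symm (A (ι v)), hmemF v hv⟩ else ⟨p, hp⟩
      source := Subtype.val ⁻¹' O
      target := T₀
      map_source' := by
        intro y hy
        have hst := (hF y hy).1 y.2
        have hq : ι (P (A.symm (ψ y))) = A.symm (ψ y) := hιP _ hst.2.1 hst.2.2
        show A (ι (P (A.symm (ψ y)))) ∈ ψ.target ∧ ψ.symm (A (ι (P (A.symm (ψ y))))) ∈ O
        rw [hq, A.apply_symm_apply, ψ.left_inv (hOψ hy)]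
        exact ⟨ψ.map_source (hOψ hy), hy⟩
      map_target' := by
        intro v hv
        show (↑(if hv : v ∈ T₀ then (⟨ψ.symm (A (ι v)), hmemF v hv⟩ : ↥(⋂ l, S l)) else ⟨p, hp⟩)
          : X) ∈ O
        rw [dif_pos hv]
        exact hv.2
      left_inv' := by
        intro y hy
        have hst := (hF y hy).1 y.2
        have hq : ι (P (A.symm (ψ y))) = A.symm (ψ y) := hιP _ hst.2.1 hst.2.2
        have hv : P (A.symm (ψ y)) ∈ T₀ := by
          show A (ι (P (A.symm (ψ y)))) ∈ ψ.target ∧ ψ.symm (A (ι (P (A.symm (ψ y))))) ∈ O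
          rw [hq, A.apply_symm_apply, ψ.left_inv (hOψ hy)]
          exact ⟨ψ.map_source (hOψ hy), hy⟩
        apply Subtype.ext
        show (↑(if hv : P (A.symm (ψ y)) ∈ T₀ then
            (⟨ψ.symm (A (ι (P (A.symm (ψ y))))), hmemF _ hv⟩ : ↥(⋂ l, S l)) else ⟨p, hp⟩) : X)
          = y
        rw [dif_pos hv]
        show ψ.symm (A (ι (P (A.symm (ψ y))))) = y
        rw [hq, A.apply_symm_apply, ψ.left_inv (hOψ hy)]
      right_inv' := by
        intro v hv
        show P (A.symm (ψ ↑(if hv : v ∈ T₀ then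
            (⟨ψ.symm (A (ι v)), hmemF v hv⟩ : ↥(⋂ l, S l)) else ⟨p, hp⟩))) = v
        rw [dif_pos hv]
        show P (A.symm (ψ (ψ.symm (A (ι v))))) = v
        rw [ψ.right_inv hv.1, A.symm_apply_apply, hPι]
      open_source := hOo.preimage continuous_subtype_val
      open_target := hT₀o
      continuousOn_toFun := by
        refine (hPc.comp_continuousOn ((A.symm.continuous.comp_continuousOn
          ψ.continuousOn).comp continuous_subtype_val.continuousOn fun y hy => ?_))
        exact hOψ hy
      continuousOn_invFun := by
        rw [Topology.IsInducing.subtypeVal.continuousOn_iff]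
        have hc : ContinuousOn (fun v => ψ.symm (A (ι v))) T₀ :=
          ψ.continuousOn_symm.comp (A.continuous.comp hιc).continuousOn fun v hv => hv.1
        refine hc.congr fun v hv => ?_
        show (↑(if hv : v ∈ T₀ then (⟨ψ.symm (A (ι v)), hmemF v hv⟩ : ↥(⋂ l, S l)) else ⟨p, hp⟩)
          : X) = ψ.symm (A (ι v))
        rw [dif_pos hv] } with he₀
  refine ⟨ψ, A, O, e₀, hψ, hOo, hpO, hOψ, hψ0, fun y hy hyF => ⟨((hF y hy).1 hyF).2.1,
    ((hF y hy).1 hyF).2.2⟩, rfl, fun y => rfl, fun y hy => ?_⟩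
  have hst := (hF y hy).1 y.2
  have hq : ι (P (A.symm (ψ y))) = A.symm (ψ y) := hιP _ hst.2.1 hst.2.2
  show ψ y = A (ι (P (A.symm (ψ y))))
  rw [hq, A.apply_symm_apply]

/-! ### Flat charts of a curve -/

/-- **Flat charts of a curve on the central surface.**  Let `S` be a Gay–Kirby trisection of the
smooth `4`-manifold `X` and `δ` a curve on its central surface `F = ⋂ l, S l`
(`Trisection.IsCurve`: the image of a smooth embedding of the circle).  Then every point `p ∈ δ`
has an open partial homeomorphism `e` of the subspace `F` to `ℝ × ℝ` with `p ∈ e.source`,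
`e p = 0` and `δ ∩ e.source = {e₂ = 0}`.  (In a plane chart of `F` at `p` the curve is a
regular smooth plane curve `c`; the chart is `Ψ⁻¹ ∘ e₀` for the local diffeomorphism
`Ψ (s, r) = c(s) + r • n` of the inverse function theorem, `n ⊥ c′(0)`.)
[cite: GayKirby2016, Def. 1 and Fig. 1] [cite: ArandaZupan2025, §2 (p. 3)] -/
theorem IsGKTrisection.exists_flatChart_of_isCurve [IsManifold (𝓡 4) ∞ X]
    (h : IsGKTrisection X g k S) {δ : Set X} (hc : Trisection.IsCurve S δ)
    (p : ↥(⋂ l, S l)) (hp : (p : X) ∈ δ) :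
    ∃ e : OpenPartialHomeomorph ↥(⋂ l, S l) (ℝ × ℝ), p ∈ e.source ∧ e p = 0 ∧
      ∀ y ∈ e.source, (y : X) ∈ δ ↔ (e y).2 = 0 := by
  classical
  obtain ⟨hδF, γ, hγ, hrange⟩ := hc
  -- the plane chart of `F` at `p`
  obtain ⟨ψ, A, O, e₀, hψ, hOo, hpO, hOψ, -, hplane, he₀src, he₀, -⟩ := h.exists_planeChart p.2
  -- the parameter of `p` and the immersion charts of `γ` there
  obtain ⟨t₀, ht₀⟩ : ∃ t, γ t = p := by
    have : (p : X) ∈ range γ := by rw [hrange]; exact hp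
    exact this
  have hat : Manifold.IsImmersionAt (𝓡 1) (𝓡 4) ∞ γ t₀ := hγ.isImmersion.isImmersionAt t₀
  set C := hat.complement with hCdef
  have hC : Manifold.IsImmersionAtOfComplement C (𝓡 1) (𝓡 4) ∞ γ t₀ :=
    hat.isImmersionAtOfComplement_complement
  set φ : OpenPartialHomeomorph ↥(Metric.sphere (0 : EuclideanSpace ℝ (Fin 2)) 1)
      (EuclideanSpace ℝ (Fin 1)) := hC.domChart with hφ
  set ψ₁ : OpenPartialHomeomorph X (EuclideanSpace ℝ (Fin 4)) := hC.codChart with hψ₁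
  set L : (EuclideanSpace ℝ (Fin 1) × C) ≃L[ℝ] EuclideanSpace ℝ (Fin 4) := hC.equiv with hL
  have ht₀φ : t₀ ∈ φ.source := hC.mem_domChart_source
  have hsrc : φ.source ⊆ γ ⁻¹' ψ₁.source := hC.source_subset_preimage_source
  have hψ₁ : ψ₁ ∈ IsManifold.maximalAtlas (𝓡 4) ∞ X := hC.codChart_mem_maximalAtlas
  have hw : ∀ u ∈ φ.target, ψ₁ (γ (φ.symm u)) = L (u, 0) := by
    intro u hu
    have hu' : u ∈ (φ.extend (𝓡 1)).target := by
      rw [OpenPartialHomeomorph.extend_target]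
      simpa using hu
    have := hC.writtenInCharts hu'
    simpa [OpenPartialHomeomorph.extend_coe, OpenPartialHomeomorph.extend_coe_symm] using this
  have hγc : Continuous γ := hγ.isEmbedding.continuous
  set u₀ : EuclideanSpace ℝ (Fin 1) := φ t₀ with hu₀def
  have hu₀ : u₀ ∈ φ.target := φ.map_source ht₀φ
  have hφu₀ : φ.symm u₀ = t₀ := φ.left_inv ht₀φ
  -- the transition `τ = ψ ∘ ψ₁⁻¹` between the two charts of `X`
  set τ : PartialEquiv (EuclideanSpace ℝ (Fin 4)) (EuclideanSpace ℝ (Fin 4)) :=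
    (𝓡 4).extendCoordChange ψ₁ ψ with hτ
  have hτ_apply : ∀ x, τ x = ψ (ψ₁.symm x) := fun x => rfl
  have hτsrc : τ.source = ψ₁.target ∩ ψ₁.symm ⁻¹' ψ.source := by
    rw [hτ, ModelWithCorners.extendCoordChange_source]
    simp only [modelWithCornersSelf_coe, image_id, OpenPartialHomeomorph.trans_source,
      OpenPartialHomeomorph.symm_source]
  have hτo : IsOpen τ.source := by
    rw [hτsrc]
    exact ψ₁.continuousOn_symm.isOpen_inter_preimage ψ₁.open_target ψ.open_source
  set x₀ : EuclideanSpace ℝ (Fin 4) := L (u₀, 0) with hx₀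
  have hx₀eq : x₀ = ψ₁ (γ t₀) := by rw [hx₀, ← hw u₀ hu₀, hφu₀]
  have hx₀src : x₀ ∈ τ.source := by
    rw [hτsrc, hx₀eq]
    refine ⟨ψ₁.map_source (hsrc ht₀φ), ?_⟩
    show ψ₁.symm (ψ₁ (γ t₀)) ∈ ψ.source
    rw [ψ₁.left_inv (hsrc ht₀φ), ht₀]
    exact hOψ hpO
  have hτon : ContDiffOn ℝ ∞ τ τ.source := (𝓡 4).contDiffOn_extendCoordChange hψ₁ hψ
  have hτcd : ContDiffAt ℝ ∞ τ x₀ := (hτon x₀ hx₀src).contDiffAt (hτo.mem_nhds hx₀src)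
  set Dτ : EuclideanSpace ℝ (Fin 4) →L[ℝ] EuclideanSpace ℝ (Fin 4) := fderiv ℝ τ x₀ with hDτ
  have hτd : HasFDerivAt τ Dτ x₀ := (hτcd.differentiableAt (by simp)).hasFDerivAt
  have hDτinj : Injective Dτ := by
    have hinv := (𝓡 4).isInvertible_fderivWithin_extendCoordChange (by simp) hψ₁ hψ hx₀src
    rw [fderivWithin_of_isOpen hτo hx₀src] at hinv
    obtain ⟨M, hM⟩ := hinv
    intro a b hab
    apply M.injective
    have : (M : EuclideanSpace ℝ (Fin 4) →L[ℝ] EuclideanSpace ℝ (Fin 4)) a =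
        (M : EuclideanSpace ℝ (Fin 4) →L[ℝ] EuclideanSpace ℝ (Fin 4)) b := by
      rw [hM]; exact hab
    exact this
  -- the curve in the plane chart: `g u = A⁻¹ ψ γ φ⁻¹ u = A⁻¹ τ L (u, 0)`
  set g : EuclideanSpace ℝ (Fin 1) → EuclideanSpace ℝ (Fin 4) := fun u => A.symm (τ (L (u, 0)))
    with hg
  have hgu : ∀ u ∈ φ.target, g u = A.symm (ψ (γ (φ.symm u))) := fun u hu => by
    simp only [hg, hτ_apply]
    rw [← hw u hu, ψ₁.left_inv (hsrc (φ.map_target hu))]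
  set Dg : EuclideanSpace ℝ (Fin 1) →L[ℝ] EuclideanSpace ℝ (Fin 4) :=
    (A.symm : EuclideanSpace ℝ (Fin 4) →L[ℝ] EuclideanSpace ℝ (Fin 4)).comp
      (Dτ.comp ((L : (EuclideanSpace ℝ (Fin 1) × C) →L[ℝ] EuclideanSpace ℝ (Fin 4)).comp
        (ContinuousLinearMap.inl ℝ (EuclideanSpace ℝ (Fin 1)) C))) with hDg
  have h1 : HasFDerivAt (fun u : EuclideanSpace ℝ (Fin 1) => L (u, 0))
      ((L : (EuclideanSpace ℝ (Fin 1) × C) →L[ℝ] EuclideanSpace ℝ (Fin 4)).comp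
        (ContinuousLinearMap.inl ℝ (EuclideanSpace ℝ (Fin 1)) C)) u₀ :=
    (L : (EuclideanSpace ℝ (Fin 1) × C) →L[ℝ] EuclideanSpace ℝ (Fin 4)).hasFDerivAt.comp u₀
      (hasFDerivAt_prodMk_left u₀ (0 : C))
  have h2 : HasFDerivAt (fun u : EuclideanSpace ℝ (Fin 1) => τ (L (u, 0)))
      (Dτ.comp ((L : (EuclideanSpace ℝ (Fin 1) × C) →L[ℝ] EuclideanSpace ℝ (Fin 4)).comp
        (ContinuousLinearMap.inl ℝ (EuclideanSpace ℝ (Fin 1)) C))) u₀ :=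
    hτd.comp u₀ h1
  have h3 : HasFDerivAt g Dg u₀ :=
    (A.symm : EuclideanSpace ℝ (Fin 4) →L[ℝ] EuclideanSpace ℝ (Fin 4)).hasFDerivAt.comp u₀ h2
  -- near `u₀` the curve stays in the plane of `F`
  have hU₂o : IsOpen (φ.target ∩ (fun u => γ (φ.symm u)) ⁻¹' O) :=
    (hγc.comp_continuousOn φ.continuousOn_symm).isOpen_inter_preimage φ.open_target hOo
  have hu₀U₂ : u₀ ∈ φ.target ∩ (fun u => γ (φ.symm u)) ⁻¹' O := ⟨hu₀, by
    show γ (φ.symm u₀) ∈ O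
    rw [hφu₀, ht₀]; exact hpO⟩
  have hplane_u : ∀ u ∈ φ.target ∩ (fun u => γ (φ.symm u)) ⁻¹' O, g u 0 = 0 ∧ g u 1 = 0 := by
    intro u hu
    rw [hgu u hu.1]
    have hF : γ (φ.symm u) ∈ ⋂ l, S l := hδF (hrange ▸ mem_range_self _)
    exact hplane _ hu.2 hF
  have hg0 : ∀ᶠ u in 𝓝 u₀, g u 0 = 0 ∧ g u 1 = 0 := by
    filter_upwards [hU₂o.mem_nhds hu₀U₂] with u hu
    exact hplane_u u hu
  -- hence the velocity lies in the plane
  set e₁ : EuclideanSpace ℝ (Fin 1) := EuclideanSpace.single (0 : Fin 1) (1 : ℝ) with he₁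
  set w : EuclideanSpace ℝ (Fin 4) := Dg e₁ with hwdef
  have hwi : ∀ i : Fin 4, (i = 0 ∨ i = 1) → w i = 0 := by
    intro i hi
    have hd : HasFDerivAt (fun u => g u i) ((EuclideanSpace.proj i : _ →L[ℝ] ℝ).comp Dg) u₀ :=
      (EuclideanSpace.proj i (𝕜 := ℝ)).hasFDerivAt.comp u₀ h3
    have hd0 : HasFDerivAt (fun u => g u i) (0 : EuclideanSpace ℝ (Fin 1) →L[ℝ] ℝ) u₀ := by
      refine (hasFDerivAt_const (0 : ℝ) u₀).congr_of_eventuallyEq ?_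
      filter_upwards [hg0] with u hu
      rcases hi with rfl | rfl
      · exact hu.1
      · exact hu.2
    have heq := hd.unique hd0
    have := DFunLike.congr_fun heq e₁
    simpa using this
  have hwne : w ≠ 0 := by
    have he₁ne : e₁ ≠ 0 := by
      intro h0
      have := congrArg (fun v : EuclideanSpace ℝ (Fin 1) => v 0) h0
      simp [he₁] at this
    have h1' : (L (e₁, (0 : C))) ≠ 0 := by
      intro h0
      have : (e₁, (0 : C)) = 0 := L.injective (by rw [h0, map_zero])
      exact he₁ne (Prod.mk_eq_zero.1 this).1
    have h2' : Dτ (L (e₁, (0 : C))) ≠ 0 := fun h0 =>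
      h1' (hDτinj (by rw [h0, map_zero]))
    intro h0
    apply h2'
    have : A.symm (Dτ (L (e₁, (0 : C)))) = 0 := by
      have hw' : w = A.symm (Dτ (L (e₁, (0 : C)))) := by
        simp [hwdef, hDg]
      rw [← hw', h0]
    simpa using this
  set c' : ℝ × ℝ := (w 2, w 3) with hc'
  have hc'sq : 0 < c'.1 ^ 2 + c'.2 ^ 2 := by
    by_contra hle
    have hle' : c'.1 ^ 2 + c'.2 ^ 2 = 0 :=
      le_antisymm (not_lt.1 hle) (add_nonneg (sq_nonneg _) (sq_nonneg _))
    have hzero := (add_eq_zero_iff_of_nonneg (sq_nonneg _) (sq_nonneg _)).1 hle'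
    have h2 : w 2 = 0 := by simpa [hc'] using hzero.1
    have h3' : w 3 = 0 := by simpa [hc'] using hzero.2
    apply hwne
    ext i
    fin_cases i
    · exact hwi 0 (Or.inl rfl)
    · exact hwi 1 (Or.inr rfl)
    · exact h2
    · exact h3'
  -- the plane curve `cc s = (g (u₀ + s e₁))₂₃` and its derivative at `0`
  set Pc : EuclideanSpace ℝ (Fin 4) →L[ℝ] ℝ × ℝ :=
    (EuclideanSpace.proj (2 : Fin 4) (𝕜 := ℝ)).prod (EuclideanSpace.proj (3 : Fin 4) (𝕜 := ℝ))
    with hPc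
  have hPc_apply : ∀ v, Pc v = (v 2, v 3) := fun v => rfl
  set cc : ℝ → ℝ × ℝ := fun s => Pc (g (u₀ + s • e₁)) with hcc
  have h4 : HasDerivAt (fun s : ℝ => u₀ + s • e₁) e₁ 0 := by
    simpa using ((hasDerivAt_id (0 : ℝ)).smul_const e₁).const_add u₀
  have h3' : HasFDerivAt g Dg (u₀ + (0 : ℝ) • e₁) := by
    rw [zero_smul, add_zero]; exact h3
  have h5 : HasDerivAt (g ∘ fun s : ℝ => u₀ + s • e₁) (Dg e₁) 0 := h3'.comp_hasDerivAt (0 : ℝ) h4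
  have h6 : HasDerivAt cc c' 0 := by
    have := Pc.hasFDerivAt.comp_hasDerivAt (0 : ℝ) h5
    exact this
  -- smoothness of the curve at `0`
  have hgcd : ContDiffAt ℝ ∞ g u₀ := by
    have hin : ContDiffAt ℝ ∞ (fun u : EuclideanSpace ℝ (Fin 1) => L (u, 0)) u₀ :=
      L.contDiff.contDiffAt.comp u₀ (contDiffAt_id.prodMk contDiffAt_const)
    exact A.symm.contDiff.contDiffAt.comp u₀ (hτcd.comp u₀ hin)
  have hcccd : ContDiffAt ℝ ∞ cc 0 := by
    have hlin : ContDiffAt ℝ ∞ (fun s : ℝ => u₀ + s • e₁) 0 :=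
      (contDiff_const.add (contDiff_id.smul contDiff_const)).contDiffAt
    have hgcd' : ContDiffAt ℝ ∞ g (u₀ + (0 : ℝ) • e₁) := by rw [zero_smul, add_zero]; exact hgcd
    have hA : ContDiffAt ℝ ∞ (g ∘ fun s : ℝ => u₀ + s • e₁) 0 := hgcd'.comp (0 : ℝ) hlin
    have hB : ContDiffAt ℝ ∞ (⇑Pc ∘ (g ∘ fun s : ℝ => u₀ + s • e₁)) 0 :=
      Pc.contDiff.contDiffAt.comp (0 : ℝ) hA
    exact hB
  -- the straightening map `Φ (s, r) = cc s + r • n`, `n ⊥ c'`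
  set nvec : ℝ × ℝ := (-c'.2, c'.1) with hnvec
  set Φ : ℝ × ℝ → ℝ × ℝ := fun v => cc v.1 + v.2 • nvec with hΦ
  set DΦ : (ℝ × ℝ) →L[ℝ] ℝ × ℝ :=
    ((ContinuousLinearMap.smulRight (1 : ℝ →L[ℝ] ℝ) c').comp (ContinuousLinearMap.fst ℝ ℝ ℝ)) +
      (ContinuousLinearMap.snd ℝ ℝ ℝ).smulRight nvec with hDΦ
  have hDΦ_apply : ∀ v : ℝ × ℝ, DΦ v = v.1 • c' + v.2 • nvec := fun v => by
    simp [hDΦ]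
  have hΦd1 : HasFDerivAt (cc ∘ Prod.fst)
      ((ContinuousLinearMap.smulRight (1 : ℝ →L[ℝ] ℝ) c').comp (ContinuousLinearMap.fst ℝ ℝ ℝ))
      (0 : ℝ × ℝ) :=
    h6.hasFDerivAt.comp (0 : ℝ × ℝ) hasFDerivAt_fst
  have hΦd2 : HasFDerivAt (fun v : ℝ × ℝ => v.2 • nvec)
      ((ContinuousLinearMap.snd ℝ ℝ ℝ).smulRight nvec) (0 : ℝ × ℝ) :=
    (hasFDerivAt_snd : HasFDerivAt (Prod.snd : ℝ × ℝ → ℝ) (ContinuousLinearMap.snd ℝ ℝ ℝ)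
      (0 : ℝ × ℝ)).smul_const nvec
  have hΦd : HasFDerivAt Φ DΦ 0 := by
    have := hΦd1.add hΦd2
    exact this
  have hΦcd : ContDiffAt ℝ ∞ Φ 0 := by
    have hA : ContDiffAt ℝ ∞ (cc ∘ Prod.fst) (0 : ℝ × ℝ) := hcccd.comp (0 : ℝ × ℝ) contDiffAt_fst
    have hB : ContDiffAt ℝ ∞ (fun v : ℝ × ℝ => v.2 • nvec) (0 : ℝ × ℝ) :=
      contDiffAt_snd.smul contDiffAt_const
    have := hA.add hB
    exact this
  have hDΦinj : Injective DΦ := by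
    intro v v' hvv
    have h0 : DΦ (v - v') = 0 := by rw [map_sub, hvv, sub_self]
    rw [hDΦ_apply] at h0
    set d : ℝ × ℝ := v - v' with hd
    have ha := congrArg Prod.fst h0
    have hb := congrArg Prod.snd h0
    simp only [hnvec, Prod.fst_add, Prod.snd_add, Prod.smul_fst, Prod.smul_snd, smul_eq_mul,
      Prod.fst_zero, Prod.snd_zero] at ha hb
    -- `ha : d.1 * c'.1 + d.2 * -c'.2 = 0`, `hb : d.1 * c'.2 + d.2 * c'.1 = 0`
    have hs : d.1 * (c'.1 ^ 2 + c'.2 ^ 2) = 0 := by linear_combination c'.1 * ha + c'.2 * hb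
    have hr : d.2 * (c'.1 ^ 2 + c'.2 ^ 2) = 0 := by linear_combination (-c'.2) * ha + c'.1 * hb
    have hs' : d.1 = 0 := (mul_eq_zero.1 hs).resolve_right hc'sq.ne'
    have hr' : d.2 = 0 := (mul_eq_zero.1 hr).resolve_right hc'sq.ne'
    have : d = 0 := Prod.ext hs' hr'
    exact sub_eq_zero.1 this
  set DΦe : (ℝ × ℝ) ≃L[ℝ] ℝ × ℝ :=
    (LinearEquiv.ofInjectiveEndo DΦ.toLinearMap hDΦinj).toContinuousLinearEquiv with hDΦe
  have hDΦe_coe : (DΦe : (ℝ × ℝ) →L[ℝ] ℝ × ℝ) = DΦ := by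
    refine ContinuousLinearMap.ext fun v => ?_
    show (LinearEquiv.ofInjectiveEndo DΦ.toLinearMap hDΦinj) v = DΦ v
    rw [LinearEquiv.coe_ofInjectiveEndo]
    rfl
  have hΦd' : HasFDerivAt Φ (DΦe : (ℝ × ℝ) →L[ℝ] ℝ × ℝ) 0 := by rw [hDΦe_coe]; exact hΦd
  set Ψ : OpenPartialHomeomorph (ℝ × ℝ) (ℝ × ℝ) := hΦcd.toOpenPartialHomeomorph Φ hΦd' (by simp)
    with hΨ
  have hΨ_apply : ∀ v, Ψ v = Φ v := fun v => rfl
  have h0Ψ : (0 : ℝ × ℝ) ∈ Ψ.source := hΦcd.mem_toOpenPartialHomeomorph_source hΦd' (by simp)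
  have hΦ0Ψ : Φ 0 ∈ Ψ.target := hΦcd.image_mem_toOpenPartialHomeomorph_target hΦd' (by simp)
  -- `Φ (s, 0) = cc s`, `Φ 0 = e₀ p`
  have hΦs0 : ∀ s : ℝ, Φ (s, 0) = cc s := fun s => by simp [hΦ]
  have he₀p : e₀ p = cc 0 := by
    rw [he₀ p, hcc]
    simp only [zero_smul, add_zero, hPc_apply]
    rw [hgu u₀ hu₀, hφu₀, ht₀]
  have hΦ0 : Φ 0 = e₀ p := by rw [he₀p, ← hΦs0 0]; rfl
  -- the radius: `Ψ.source`, the chart target of `φ`, and `O`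
  obtain ⟨ρ₁, hρ₁, hball₁⟩ := Metric.isOpen_iff.1 Ψ.open_source 0 h0Ψ
  obtain ⟨ρ₂, hρ₂, hball₂⟩ := Metric.isOpen_iff.1 hU₂o u₀ hu₀U₂
  set ρ : ℝ := min ρ₁ ρ₂ with hρ
  have hρpos : 0 < ρ := lt_min hρ₁ hρ₂
  have he₁norm : ‖e₁‖ = 1 := by simp [he₁]
  have hnorm_s : ∀ s : ℝ, ‖u₀ + s • e₁ - u₀‖ = |s| := fun s => by
    rw [add_sub_cancel_left, norm_smul, he₁norm, mul_one, Real.norm_eq_abs]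
  have hsU₂ : ∀ s : ℝ, |s| < ρ → u₀ + s • e₁ ∈ φ.target ∩ (fun u => γ (φ.symm u)) ⁻¹' O := by
    intro s hs
    refine hball₂ ?_
    rw [Metric.mem_ball, dist_eq_norm, hnorm_s]
    exact lt_of_lt_of_le hs (min_le_right _ _)
  have hsΨ : ∀ s : ℝ, |s| < ρ → ((s, (0 : ℝ)) : ℝ × ℝ) ∈ Ψ.source := by
    intro s hs
    refine hball₁ ?_
    rw [Metric.mem_ball, dist_zero_right, Prod.norm_mk, Real.norm_eq_abs, norm_zero,
      max_eq_left (abs_nonneg s)]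
    exact lt_of_lt_of_le hs (min_le_left _ _)
  -- the link between the curve and the plane chart
  have hlink : ∀ s : ℝ, |s| < ρ →
      ∃ hmem : γ (φ.symm (u₀ + s • e₁)) ∈ ⋂ l, S l,
        (⟨γ (φ.symm (u₀ + s • e₁)), hmem⟩ : ↥(⋂ l, S l)) ∈ e₀.source ∧
        e₀ ⟨γ (φ.symm (u₀ + s • e₁)), hmem⟩ = cc s := by
    intro s hs
    have hu := hsU₂ s hs
    have hmem : γ (φ.symm (u₀ + s • e₁)) ∈ ⋂ l, S l := hδF (hrange ▸ mem_range_self _)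
    refine ⟨hmem, ?_, ?_⟩
    · rw [he₀src]; exact hu.2
    · rw [he₀, hcc]
      simp only [hPc_apply]
      rw [hgu _ hu.1]
  -- the neighbourhood of `t₀` in the circle read through the embedding
  set N : Set ↥(Metric.sphere (0 : EuclideanSpace ℝ (Fin 2)) 1) :=
    φ.source ∩ φ ⁻¹' Metric.ball u₀ ρ with hN
  have hNo : IsOpen N := φ.isOpen_inter_preimage Metric.isOpen_ball
  obtain ⟨V, hVo, hVN⟩ := hγ.isEmbedding.isInducing.isOpen_iff.1 hNo
  have ht₀N : t₀ ∈ N := by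
    refine ⟨ht₀φ, ?_⟩
    show φ t₀ ∈ Metric.ball u₀ ρ
    rw [Metric.mem_ball, ← hu₀def, dist_self]
    exact hρpos
  have hpV : (p : X) ∈ V := by
    have : t₀ ∈ γ ⁻¹' V := by rw [hVN]; exact ht₀N
    rw [← ht₀]; exact this
  -- the chart
  set e : OpenPartialHomeomorph ↥(⋂ l, S l) (ℝ × ℝ) :=
    ((e₀.restrOpen (Subtype.val ⁻¹' V) (hVo.preimage continuous_subtype_val)).trans Ψ.symm).trans
      (OpenPartialHomeomorph.ofSet (Metric.ball (0 : ℝ × ℝ) ρ) Metric.isOpen_ball) with hedef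
  have he_apply : ∀ y, e y = Ψ.symm (e₀ y) := fun y => rfl
  have he_source : ∀ y, y ∈ e.source ↔ (y ∈ e₀.source ∧ (y : X) ∈ V) ∧ e₀ y ∈ Ψ.target ∧
      Ψ.symm (e₀ y) ∈ Metric.ball (0 : ℝ × ℝ) ρ := fun y => by
    simp only [hedef, OpenPartialHomeomorph.trans_source, OpenPartialHomeomorph.restrOpen_source,
      OpenPartialHomeomorph.symm_source, OpenPartialHomeomorph.ofSet_source, mem_inter_iff,
      mem_preimage, OpenPartialHomeomorph.coe_trans, OpenPartialHomeomorph.coe_restrOpen,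
      comp_apply, and_assoc]
  have hpe₀ : p ∈ e₀.source := by rw [he₀src]; exact hpO
  have hep : e p = 0 := by
    rw [he_apply, ← hΦ0]
    exact Ψ.left_inv h0Ψ
  refine ⟨e, ?_, hep, fun y hy => ?_⟩
  · rw [he_source]
    refine ⟨⟨hpe₀, hpV⟩, by rw [← hΦ0]; exact hΦ0Ψ, ?_⟩
    rw [← he_apply, hep]
    exact Metric.mem_ball_self hρpos
  obtain ⟨⟨hye₀, hyV⟩, hyΨ, hyball⟩ := (he_source y).1 hy
  constructor
  · -- a point of `δ` near `p` is `γ t` with `φ t` close to `u₀`, hence on the straightened line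
    intro hyδ
    obtain ⟨t, hty⟩ : (y : X) ∈ range γ := by rw [hrange]; exact hyδ
    have htN : t ∈ N := by
      have : t ∈ γ ⁻¹' V := by show γ t ∈ V; rw [hty]; exact hyV
      rwa [hVN] at this
    set sc : ℝ := (φ t - u₀) 0 with hsc
    have hφt : φ t = u₀ + sc • e₁ := by
      -- every vector of `ℝ¹` is a multiple of the basis vector
      have : φ t - u₀ = sc • e₁ := by
        ext i
        fin_cases i
        simp [hsc, he₁]
      rw [← this, add_sub_cancel]
    have hsabs : |sc| < ρ := by
      have h1 : ‖φ t - u₀‖ < ρ := by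
        have := htN.2
        rwa [mem_preimage, Metric.mem_ball, dist_eq_norm] at this
      rwa [show φ t - u₀ = u₀ + sc • e₁ - u₀ by rw [← hφt], hnorm_s] at h1
    obtain ⟨hmem, -, hval⟩ := hlink sc hsabs
    have hyeq : y = ⟨γ (φ.symm (u₀ + sc • e₁)), hmem⟩ := by
      apply Subtype.ext
      show (y : X) = γ (φ.symm (u₀ + sc • e₁))
      rw [← hφt, φ.left_inv htN.1, hty]
    rw [he_apply, hyeq, hval, ← hΦs0, ← hΨ_apply, Ψ.left_inv (hsΨ sc hsabs)]
  · -- a point with `e₂ = 0` is the image of a point of the curve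
    intro hy2
    set v : ℝ × ℝ := Ψ.symm (e₀ y) with hv
    have hv2 : v.2 = 0 := hy2
    have hvnorm : |v.1| < ρ := by
      have h1 : ‖v‖ < ρ := by rwa [Metric.mem_ball, dist_zero_right] at hyball
      exact lt_of_le_of_lt (by rw [← Real.norm_eq_abs]; exact norm_fst_le v) h1
    have hveq : v = (v.1, 0) := Prod.ext rfl hv2
    have hΨv : Ψ v = e₀ y := Ψ.right_inv hyΨ
    obtain ⟨hmem, hsrc', hval⟩ := hlink v.1 hvnorm
    have hcc_eq : e₀ y = cc v.1 := by
      rw [← hΨv, hΨ_apply, hveq, hΦs0]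
    have hyeq : y = ⟨γ (φ.symm (u₀ + v.1 • e₁)), hmem⟩ :=
      e₀.injOn hye₀ hsrc' (by rw [hcc_eq, hval])
    rw [hyeq]
    show γ (φ.symm (u₀ + v.1 • e₁)) ∈ δ
    rw [← hrange]
    exact mem_range_self _

/-- **The two sides of a separating curve on the central surface** (unconditional form of
`IsGKTrisection.exists_two_sides_of_not_isNonSeparating`, the flat charts being supplied by
`IsGKTrisection.exists_flatChart_of_isCurve`): for a Gay–Kirby trisection of a smooth
`4`-manifold and a separating curve `δ` on the central surface `F`, `F ∖ δ = F₁ ⊔ F₂` with both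
sides connected, relatively open, `closure Fᵢ = Fᵢ ∪ δ`, and every preconnected subset of
`F ∖ δ` inside one side. [cite: ArandaZupan2025, §2 p. 6 (separating reducing curves)]
[cite: MeierSchirmerZupan2016, §3 proof of Proposition 3.9] -/
theorem IsGKTrisection.exists_two_sides_of_not_isNonSeparating' [IsManifold (𝓡 4) ∞ X]
    (h : IsGKTrisection X g k S) {δ : Set X} (hc : Trisection.IsCurve S δ)
    (hsep : ¬ Trisection.IsNonSeparating S δ) :
    ∃ F₁ F₂ : Set X, F₁ ∪ F₂ = (⋂ l, S l) \ δ ∧ Disjoint F₁ F₂ ∧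
      IsConnected F₁ ∧ IsConnected F₂ ∧
      IsOpen (Subtype.val ⁻¹' F₁ : Set ↥(⋂ l, S l)) ∧
      IsOpen (Subtype.val ⁻¹' F₂ : Set ↥(⋂ l, S l)) ∧
      closure F₁ = F₁ ∪ δ ∧ closure F₂ = F₂ ∪ δ ∧
      ∀ P ⊆ (⋂ l, S l) \ δ, IsPreconnected P → P ⊆ F₁ ∨ P ⊆ F₂ :=
  h.exists_two_sides_of_not_isNonSeparating hc hsep fun p hp =>
    h.exists_flatChart_of_isCurve hc p hp

end Literature.Topology.FourManifolds

end
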